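import Summits.BirchSwinnertonDyer.BirchSwinnertonDyer.Theorems.AlignedTransportAtTwoOffStratumPartitionTwistFamilyZhai
import Summits.BirchSwinnertonDyer.Rank1Residual.P2.TransportAtTwo
import Literature.NumberTheory.EllipticCurves.Zhai2016.TwoPartBSDQuadraticTwistsV2
import HarnessLib

/-!
# Route `AlignedTransportAtTwo`, crux C2 `MainConjectureOfRankZeroBSDAtTwo` (stmt-22298), line `birth` — THE PRINTED HALF OF THE TWIST
# FAMILIES: on the SPLIT Zhai sub-family (every bad prime of the seed split in `ℚ(√M)`) `BSD(W, 2)` is Zhai 2016 arXiv-v2 Thm. 1.2 read in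
# Miller's currency — NO Kato, NO Matsuno, NO Greenberg, NO tower certificate, NO hypothesis at `2`

HONEST FRAMING (cell `bsd-f1-sign2`, WIDTH-5 attach seat `bsd-line-att-p4` g23; `--supports stmt-BirchSwinnertonDyer-22298 --as helper`).
THEOREMS ONLY (no `def`, no named fact, no `sorry`). BSD is NOT proved; C1/C2/C3′ are NOT closed; nothing is asserted — every statement is
CONDITIONAL on the displayed PRINT named facts (hypotheses) and the seed's displayed data.

WHY. Sequel of `…TwistFamilyZhai` (same seat, same gen). There the Zhai sub-family T_Z of the twist family of a certified seed got `BSD(W,2)`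
from the cell's road (PRINT⁷ + Zhai 1.1 + certificate). Zhai's arXiv v2 adds Theorem 1.2 (vendored this gen as the Literature fact
`Zhai2016.thm12v2_twoPartBSD_twist_of_split`, p747944): under the hypotheses of Thm. 1.1, if moreover every bad prime of `S` splits in
`ℚ(√M)` and the `2`-part of BSD holds for `S`, then the `2`-part of BSD holds for `S^{(M)}`. So on the SPLIT part T_Z^split the rank-zero
leaf is PRINT OUTRIGHT (given `BSD(S,2)`, itself print for the five small seeds by Creutz–Miller): this file is that reading, in the route's
currency `BSDp` (Miller), through b2b-p2's bridges `P2.pPartBSD_two_of_bsdp` / `P2.bsdp_two_of_pPartBSD` (modularity + GZK for the currency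
change only).

* §1 **`bsdp_two_twist_zhaiSplit_of_print`** — `S` globally minimal with Zhai data {optimality datum `Dt` with odd Manin constant, `Δ_S < 0`, no
  rational `2`-torsion abscissa, `ord₂(L(S,1)/Ω_∞(S)) = 0`, cubic field `F`} and `BSDp S 2` (from WHATEVER source); `M` square-free, `M ≡ 1 (mod 4)`,
  `(M, N_S) = 1`, `r ≥ 1` odd prime factors inert in `F`, every prime of `N_S` split in every quadratic field containing `√M`; `W` ANY globally
  minimal model of `S^{(M)}`. Then `BSDp W 2`, modulo PRINT⁴ {Zhai 2016 Thm. 1.1 (v2-corrected), Zhai arXiv v2 Thm. 1.2, modularity, GZK}.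
  NOTHING about the reduction of `S` at `2` is used (Zhai's theorem has no hypothesis at `2`): the statement is not special to the cell.
* §2 the five small certified seeds (`BSD(S,2)` := Creutz–Miller, `N_S < 5000`): **`bsdp_two_twist_zhaiSplit_1727a1`** (bad primes `11`, `157`),
  `…_2071a1` (`19`, `109`), `…_4087a1` / `…_4087c1` (`61`, `67`), `…_2045b1` (`5`, `409`): `BSD(W, 2)` for every globally minimal model of
  `S^{(M)}`, `M` Zhai-admissible with the bad primes split, modulo PRINT⁵ {Zhai 1.1, Zhai v2 1.2, Creutz–Miller 1.1, GZK, modularity} + displayed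
  {`X₀(N_S)`-optimality datum with odd Manin constant (`N_S` odd — Abbes–Ullmo in substance, not discharged here), `ord₂(L(S,1)/Ω_∞(S)) = 0`}.
  No `TowerGapAtTwo`, no Kato: the (T) row's rank-zero leaf is CLOSED IN PRINT on T_Z^split for these seeds (modulo the two displayed data).

PARTITION CURRENCY (D-0171): (T) ⊃ T_Z ⊃ T_Z^split; rank-`0` leaf: T_Z^split PRINT (this file), T_Z ∖ T_Z^split PRINT⁸ + cert (`…TwistFamilyZhai`),
(T) ∖ T_Z with `r_an(W) = 0` PRINT⁷ + cert + `r_an(W) = 0` (g22). REMARK for the route: every member of T_Z^split is a rank-`0`, good-ordinary,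
`S₃`-image curve with `BSD(W,2)` IN PRINT — a print-certified SEED of unbounded conductor (Creutz–Miller stops at `N < 5000`); its `MC₂` still
comes only through the seed's tower certificate (g22 `mazurMainConjecture_two_twist_of_certified_seed`). Beyond-print theorem: no. BSD is NOT proved.

References: [Zhai2016] Thm. 1.1 and arXiv v2 Thm. 1.2 (TeX ll. 273–285); [CreutzMiller2012] Thm. 1.1; [Miller2011LMS] Def. 1.1; [Darmon2004]
Thm. 3.22; [BCDTJAMS2001] Thm. A; [CremonaAlgorithms1997] Table 1.
-/

set_option autoImplicit false
set_option linter.dupNamespace false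

noncomputable section

open scoped Classical MatrixGroups ModularForm

open CongruenceSubgroup WeierstrassCurve Polynomial NumberField IsDedekindDomain
open Literature.NumberTheory.EllipticCurves Literature.NumberTheory.EllipticCurves.ModularForms
open Literature.NumberTheory.EllipticCurves.Greenberg1999 Literature.NumberTheory.EllipticCurves.GreenbergVatsal2000
open Literature.NumberTheory.EllipticCurves.Rank1Residual Literature.NumberTheory.EllipticCurves.Rank1Residual.Typed
open Literature.NumberTheory.EllipticCurves.CoatesLiTianZhai2015 Literature.NumberTheory.EllipticCurves.Zhai2016
open Summit.BirchSwinnertonDyer.Rank1Residual Summit.BirchSwinnertonDyer.Rank1Residual.F1Sign2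
open Summit.BirchSwinnertonDyer.Rank1Residual.X1.MuLambda Summit.BirchSwinnertonDyer.Rank1Residual.X5
open Summit.BirchSwinnertonDyer.BirchSwinnertonDyer.Theorems.Rank1ResidualX1Defs
open Summit.BirchSwinnertonDyer.BirchSwinnertonDyer.Theses.AlignedTransportAtTwo
open Summit.BirchSwinnertonDyer.BirchSwinnertonDyer.Theorems.AlignedTransportAtTwoTwistFamilySmallSeeds
open Summit.BirchSwinnertonDyer.BirchSwinnertonDyer.Theorems.AlignedTransportAtTwoTwistFamilyZhai
open Summit.BirchSwinnertonDyer.BirchSwinnertonDyer.Theorems.AlignedTransportAtTwoOffStratumRow2045b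
open Summit.BirchSwinnertonDyer.BirchSwinnertonDyer.Theorems.TowerClass
open Summit.BirchSwinnertonDyer.BirchSwinnertonDyer.Theorems

namespace Summit.BirchSwinnertonDyer.BirchSwinnertonDyer.Theorems.AlignedTransportAtTwoTwistFamilyZhaiSplit

/-! ## §1 The split Zhai sub-family: `BSD(W, 2)` from PRINT only -/

section Family

variable (S : WeierstrassCurve ℚ) [S.IsElliptic] [S.IsGloballyMinimal] [NeZero (S.conductorNorm ℤ)]
  (W : WeierstrassCurve ℚ) [W.IsElliptic] [W.IsGloballyMinimal]

/-- **`BSD(W, 2)` ON THE SPLIT ZHAI SUB-FAMILY, FROM PRINT ONLY.** `S` globally minimal with an optimality datum `Dt` of odd Manin constant,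
`Δ_S < 0`, no rational `2`-torsion abscissa, `ord₂(L(S,1)/Ω_∞(S)) = 0`, `F` a cubic field of the `2`-division polynomial, and `BSDp S 2` (from any
source); `M` square-free, `M ≡ 1 (mod 4)`, `(M, N_S) = 1`, `r ≥ 1` odd prime factors all inert in `F`, every prime of the conductor `N_S` split in
every quadratic field containing `√M`; `W` ANY globally minimal model of `S^{(M)}`. Then `BSDp W 2`, modulo PRINT⁴ {Zhai 2016 Thm. 1.1
(v2-corrected), Zhai arXiv v2 Thm. 1.2, modularity, GZK}: `BSDp S 2 ⟹ pPartBSD S 2` (b2b-p2 bridge, `r_an(S) = 0` from the Zhai datum) ⟹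
`pPartBSD W 2` (Zhai v2 Thm. 1.2) ⟹ `BSDp W 2` (bridge back, `r_an(W) = 0` from Zhai Thm. 1.1). No hypothesis on the reduction of `S` at `2`,
no Kato, no Matsuno, no Greenberg, no tower certificate. CONDITIONAL on the four named facts; BSD is NOT proved.
[cite: Zhai2016, Thm. 1.1 and arXiv:1409.0231v2 Thm. 1.2 (TeX ll. 273–285)] [cite: Miller2011LMS, Def. 1.1] [cite: Darmon2004, Thm. 3.22] -/
theorem bsdp_two_twist_zhaiSplit_of_print
    (hmod : nonempty_modularParametrizationData) (hGZK : rank_eq_analyticRank_of_analyticRank_le_one)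
    (h11 : thm11_ordTwo_LAlg_twist_eq_zero') (h12 : thm12v2_twoPartBSD_twist_of_split)
    -- the seed: Zhai data + `BSD(S, 2)`
    (Dt : ModularParametrizationData S (S.conductorNorm ℤ)) (hopt : Zhai2021.IsOptimalDatum S Dt) (hν : ¬ (2 : ℤ) ∣ Dt.c)
    (hΔ : S.Δ < 0) (htS : ∀ x : ℚ, ¬ HasRationalTwoTorsionX S x)
    (hL : ∃ x : ℚ, IsLAlg S x ∧ x ≠ 0 ∧ padicValRat 2 x = 0)
    (F : Type) [Field F] [NumberField F] (hF : IsTwoDivisionField S F) (hbsdS : BSDp S 2)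
    -- the member: Zhai's `M`, split at the bad primes, and the twist relation
    (M : ℤ) (hsq : Squarefree M) (hM4 : M % 4 = 1) (hgcd : Int.gcd M (S.conductorNorm ℤ) = 1)
    (hne : M.natAbs.primeFactors.Nonempty) (hin : ∀ q ∈ M.natAbs.primeFactors, q ≠ 2 ∧ IsInertIn F q)
    (hsplit : ∀ (K : Type) [Field K] [NumberField K], Module.finrank ℚ K = 2 → (∃ x : K, x ^ 2 = (M : K)) →
      SatisfiesHeegnerHypothesis (S.conductorNorm ℤ) K)
    {c : VariableChange ℚ} (hc : c • S.quadraticTwist (M : ℚ) = W) : BSDp W 2 := by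
  have hmod' : hasEntireLFunction_rat := WeierstrassCurve.hasEntireLFunction_rat_of_exists_isNewformOf
    (exists_isNewformOf_of_nonempty_modularParametrizationData hmod)
  have h1 := natCard_twoTorsion_eq_one_of_forall_not_hasRationalTwoTorsionX S htS
  have hrS : S.analyticRank = 0 := analyticRank_eq_zero_of_isLAlg S hL
  have hpS : CaiLiZhai2019.pPartBSD S 2 := P2.pPartBSD_two_of_bsdp hmod' hGZK S (by omega) hbsdS
  have hpW : CaiLiZhai2019.pPartBSD W 2 := h12 S Dt hopt hν hΔ h1 hL F hF M hsq hM4 hgcd hne hin hsplit hpS W ⟨c, hc⟩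
  have hrW : W.analyticRank = 0 := analyticRank_eq_zero_twist_of_zhai11' S W h11 Dt hopt hν hΔ htS hL F hF M hsq hM4 hgcd hne hin hc
  exact P2.bsdp_two_of_pPartBSD hmod' hGZK W (by omega) hpW

/-- **On the split Zhai sub-family the member is itself a print-certified rank-zero curve**: `r_an(W) = 0` (Zhai 1.1) AND `BSDp W 2` (previous
theorem) — the two clauses a SEED `W′` of the route's cell predicate must carry from print, here for curves of unbounded conductor (same inputs).
CONDITIONAL; BSD is NOT proved. [cite: Zhai2016, Thm. 1.1 and arXiv:1409.0231v2 Thm. 1.2 (TeX ll. 273–285)] [cite: Miller2011LMS, Def. 1.1] -/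
theorem analyticRank_eq_zero_and_bsdp_two_twist_zhaiSplit_of_print
    (hmod : nonempty_modularParametrizationData) (hGZK : rank_eq_analyticRank_of_analyticRank_le_one)
    (h11 : thm11_ordTwo_LAlg_twist_eq_zero') (h12 : thm12v2_twoPartBSD_twist_of_split)
    (Dt : ModularParametrizationData S (S.conductorNorm ℤ)) (hopt : Zhai2021.IsOptimalDatum S Dt) (hν : ¬ (2 : ℤ) ∣ Dt.c)
    (hΔ : S.Δ < 0) (htS : ∀ x : ℚ, ¬ HasRationalTwoTorsionX S x)
    (hL : ∃ x : ℚ, IsLAlg S x ∧ x ≠ 0 ∧ padicValRat 2 x = 0)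
    (F : Type) [Field F] [NumberField F] (hF : IsTwoDivisionField S F) (hbsdS : BSDp S 2)
    (M : ℤ) (hsq : Squarefree M) (hM4 : M % 4 = 1) (hgcd : Int.gcd M (S.conductorNorm ℤ) = 1)
    (hne : M.natAbs.primeFactors.Nonempty) (hin : ∀ q ∈ M.natAbs.primeFactors, q ≠ 2 ∧ IsInertIn F q)
    (hsplit : ∀ (K : Type) [Field K] [NumberField K], Module.finrank ℚ K = 2 → (∃ x : K, x ^ 2 = (M : K)) →
      SatisfiesHeegnerHypothesis (S.conductorNorm ℤ) K)
    {c : VariableChange ℚ} (hc : c • S.quadraticTwist (M : ℚ) = W) : W.analyticRank = 0 ∧ BSDp W 2 :=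
  ⟨analyticRank_eq_zero_twist_of_zhai11' S W h11 Dt hopt hν hΔ htS hL F hF M hsq hM4 hgcd hne hin hc,
    bsdp_two_twist_zhaiSplit_of_print S W hmod hGZK h11 h12 Dt hopt hν hΔ htS hL F hF hbsdS M hsq hM4 hgcd hne hin hsplit hc⟩

end Family

/-! ## §2 The five small certified seeds: `BSD(S, 2)` from Creutz–Miller — print-complete rows -/

section SmallSeeds

variable (W : WeierstrassCurve ℚ) [W.IsElliptic] [W.IsGloballyMinimal]
  (hmod : nonempty_modularParametrizationData) (hGZK : rank_eq_analyticRank_of_analyticRank_le_one)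
  (hCM : bsdTriple_of_rank_le_one_of_conductor_lt)
  (h11 : thm11_ordTwo_LAlg_twist_eq_zero') (h12 : thm12v2_twoPartBSD_twist_of_split)
  (F : Type) [Field F] [NumberField F] (M : ℤ)

include hmod hGZK hCM h11 h12 in
/-- **`BSD(W, 2)` FROM PRINT for EVERY globally minimal model `W` of `1727a1^{(M)}`**, `M` square-free, `M ≡ 1 (mod 4)`, `(M, 1727) = 1`, with `r ≥ 1`
odd prime factors each inert in a cubic field `F` of the `2`-division polynomial of `1727a1`, and `11`, `157` split in every quadratic field
containing `√M` — modulo PRINT⁵ {Zhai 2016 Thm. 1.1, Zhai arXiv v2 Thm. 1.2, Creutz–Miller 1.1, GZK, modularity} + displayed {`Dt` an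
`X₀(1727)`-optimality datum of `1727a1` with odd Manin constant, `ord₂(L(1727a1,1)/Ω_∞) = 0`}. No Kato, no tower certificate, nothing at `2`.
CONDITIONAL; BSD is NOT proved. [cite: Zhai2016, Thm. 1.1 and arXiv:1409.0231v2 Thm. 1.2 (TeX ll. 273–285)] [cite: CreutzMiller2012, Thm. 1.1]
[cite: Miller2011LMS, Def. 1.1] -/
theorem bsdp_two_twist_zhaiSplit_1727a1 [NeZero (c1727a1.conductorNorm ℤ)]
    (Dt : ModularParametrizationData c1727a1 (c1727a1.conductorNorm ℤ)) (hopt : Zhai2021.IsOptimalDatum c1727a1 Dt) (hν : ¬ (2 : ℤ) ∣ Dt.c)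
    (hL : ∃ x : ℚ, IsLAlg c1727a1 x ∧ x ≠ 0 ∧ padicValRat 2 x = 0)
    (hF : IsTwoDivisionField c1727a1 F) (hsq : Squarefree M) (hM4 : M % 4 = 1) (hgcd : Int.gcd M 1727 = 1)
    (hne : M.natAbs.primeFactors.Nonempty) (hin : ∀ q ∈ M.natAbs.primeFactors, q ≠ 2 ∧ IsInertIn F q)
    (hsplit : ∀ (K : Type) [Field K] [NumberField K], Module.finrank ℚ K = 2 → (∃ x : K, x ^ 2 = (M : K)) →
      SatisfiesHeegnerHypothesis 1727 K)
    {c : VariableChange ℚ} (hc : c • c1727a1.quadraticTwist (M : ℚ) = W) : BSDp W 2 :=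
  bsdp_two_twist_zhaiSplit_of_print c1727a1 W hmod hGZK h11 h12 Dt hopt hν Δ_1727a1_neg' not_hasRationalTwoTorsionX_1727a1 hL F hF
    (bsdp_two_1727a1_of_creutzMiller hCM hGZK (analyticRank_eq_zero_of_isLAlg c1727a1 hL)) M hsq hM4 (by rwa [conductorNorm_1727a1]) hne hin
    (by rw [conductorNorm_1727a1]; exact hsplit) hc

include hmod hGZK hCM h11 h12 in
/-- **`BSD(W, 2)` FROM PRINT for every globally minimal model of `2071a1^{(M)}`** (`M` Zhai-admissible, `(M, 2071) = 1`, `19` and `109` split in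
`ℚ(√M)`), modulo PRINT⁵ + {optimality datum with odd Manin constant, `ord₂ L^{alg}(2071a1) = 0`}. CONDITIONAL; BSD is NOT proved.
[cite: Zhai2016, Thm. 1.1 and arXiv:1409.0231v2 Thm. 1.2] [cite: CreutzMiller2012, Thm. 1.1] [cite: Miller2011LMS, Def. 1.1] -/
theorem bsdp_two_twist_zhaiSplit_2071a1 [NeZero (c2071a1.conductorNorm ℤ)]
    (Dt : ModularParametrizationData c2071a1 (c2071a1.conductorNorm ℤ)) (hopt : Zhai2021.IsOptimalDatum c2071a1 Dt) (hν : ¬ (2 : ℤ) ∣ Dt.c)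
    (hL : ∃ x : ℚ, IsLAlg c2071a1 x ∧ x ≠ 0 ∧ padicValRat 2 x = 0)
    (hF : IsTwoDivisionField c2071a1 F) (hsq : Squarefree M) (hM4 : M % 4 = 1) (hgcd : Int.gcd M 2071 = 1)
    (hne : M.natAbs.primeFactors.Nonempty) (hin : ∀ q ∈ M.natAbs.primeFactors, q ≠ 2 ∧ IsInertIn F q)
    (hsplit : ∀ (K : Type) [Field K] [NumberField K], Module.finrank ℚ K = 2 → (∃ x : K, x ^ 2 = (M : K)) →
      SatisfiesHeegnerHypothesis 2071 K)
    {c : VariableChange ℚ} (hc : c • c2071a1.quadraticTwist (M : ℚ) = W) : BSDp W 2 :=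
  bsdp_two_twist_zhaiSplit_of_print c2071a1 W hmod hGZK h11 h12 Dt hopt hν Δ_2071a1_neg' not_hasRationalTwoTorsionX_2071a1 hL F hF
    (bsdp_two_2071a1_of_creutzMiller hCM hGZK (analyticRank_eq_zero_of_isLAlg c2071a1 hL)) M hsq hM4 (by rwa [conductorNorm_2071a1]) hne hin
    (by rw [conductorNorm_2071a1]; exact hsplit) hc

include hmod hGZK hCM h11 h12 in
/-- **`BSD(W, 2)` FROM PRINT for every globally minimal model of `4087a1^{(M)}`** (`M` Zhai-admissible, `(M, 4087) = 1`, `61` and `67` split in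
`ℚ(√M)`), modulo PRINT⁵ + {optimality datum with odd Manin constant, `ord₂ L^{alg}(4087a1) = 0`}. CONDITIONAL; BSD is NOT proved.
[cite: Zhai2016, Thm. 1.1 and arXiv:1409.0231v2 Thm. 1.2] [cite: CreutzMiller2012, Thm. 1.1] [cite: Miller2011LMS, Def. 1.1] -/
theorem bsdp_two_twist_zhaiSplit_4087a1 [NeZero (c4087a1.conductorNorm ℤ)]
    (Dt : ModularParametrizationData c4087a1 (c4087a1.conductorNorm ℤ)) (hopt : Zhai2021.IsOptimalDatum c4087a1 Dt) (hν : ¬ (2 : ℤ) ∣ Dt.c)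
    (hL : ∃ x : ℚ, IsLAlg c4087a1 x ∧ x ≠ 0 ∧ padicValRat 2 x = 0)
    (hF : IsTwoDivisionField c4087a1 F) (hsq : Squarefree M) (hM4 : M % 4 = 1) (hgcd : Int.gcd M 4087 = 1)
    (hne : M.natAbs.primeFactors.Nonempty) (hin : ∀ q ∈ M.natAbs.primeFactors, q ≠ 2 ∧ IsInertIn F q)
    (hsplit : ∀ (K : Type) [Field K] [NumberField K], Module.finrank ℚ K = 2 → (∃ x : K, x ^ 2 = (M : K)) →
      SatisfiesHeegnerHypothesis 4087 K)
    {c : VariableChange ℚ} (hc : c • c4087a1.quadraticTwist (M : ℚ) = W) : BSDp W 2 :=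
  bsdp_two_twist_zhaiSplit_of_print c4087a1 W hmod hGZK h11 h12 Dt hopt hν Δ_4087a1_neg' not_hasRationalTwoTorsionX_4087a1 hL F hF
    (bsdp_two_4087a1_of_creutzMiller hCM hGZK (analyticRank_eq_zero_of_isLAlg c4087a1 hL)) M hsq hM4 (by rwa [conductorNorm_4087a1]) hne hin
    (by rw [conductorNorm_4087a1]; exact hsplit) hc

include hmod hGZK hCM h11 h12 in
/-- **`BSD(W, 2)` FROM PRINT for every globally minimal model of `4087c1^{(M)}`** (`M` Zhai-admissible, `(M, 4087) = 1`, `61` and `67` split in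
`ℚ(√M)`), modulo PRINT⁵ + {optimality datum with odd Manin constant, `ord₂ L^{alg}(4087c1) = 0`}. CONDITIONAL; BSD is NOT proved.
[cite: Zhai2016, Thm. 1.1 and arXiv:1409.0231v2 Thm. 1.2] [cite: CreutzMiller2012, Thm. 1.1] [cite: Miller2011LMS, Def. 1.1] -/
theorem bsdp_two_twist_zhaiSplit_4087c1 [NeZero (c4087c1.conductorNorm ℤ)]
    (Dt : ModularParametrizationData c4087c1 (c4087c1.conductorNorm ℤ)) (hopt : Zhai2021.IsOptimalDatum c4087c1 Dt) (hν : ¬ (2 : ℤ) ∣ Dt.c)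
    (hL : ∃ x : ℚ, IsLAlg c4087c1 x ∧ x ≠ 0 ∧ padicValRat 2 x = 0)
    (hF : IsTwoDivisionField c4087c1 F) (hsq : Squarefree M) (hM4 : M % 4 = 1) (hgcd : Int.gcd M 4087 = 1)
    (hne : M.natAbs.primeFactors.Nonempty) (hin : ∀ q ∈ M.natAbs.primeFactors, q ≠ 2 ∧ IsInertIn F q)
    (hsplit : ∀ (K : Type) [Field K] [NumberField K], Module.finrank ℚ K = 2 → (∃ x : K, x ^ 2 = (M : K)) →
      SatisfiesHeegnerHypothesis 4087 K)
    {c : VariableChange ℚ} (hc : c • c4087c1.quadraticTwist (M : ℚ) = W) : BSDp W 2 :=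
  bsdp_two_twist_zhaiSplit_of_print c4087c1 W hmod hGZK h11 h12 Dt hopt hν Δ_4087c1_neg' not_hasRationalTwoTorsionX_4087c1 hL F hF
    (bsdp_two_4087c1_of_creutzMiller hCM hGZK (analyticRank_eq_zero_of_isLAlg c4087c1 hL)) M hsq hM4 (by rwa [conductorNorm_4087c1]) hne hin
    (by rw [conductorNorm_4087c1]; exact hsplit) hc

include hmod hGZK hCM h11 h12 in
/-- **`BSD(W, 2)` FROM PRINT for every globally minimal model of `2045b1^{(M)}`** (`M` Zhai-admissible, `(M, 2045) = 1`, `5` and `409` split in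
`ℚ(√M)`), modulo PRINT⁵ + {optimality datum with odd Manin constant, `ord₂ L^{alg}(2045b1) = 0`}. CONDITIONAL; BSD is NOT proved.
[cite: Zhai2016, Thm. 1.1 and arXiv:1409.0231v2 Thm. 1.2] [cite: CreutzMiller2012, Thm. 1.1] [cite: Miller2011LMS, Def. 1.1] -/
theorem bsdp_two_twist_zhaiSplit_2045b1 [NeZero (c2045b1.conductorNorm ℤ)]
    (Dt : ModularParametrizationData c2045b1 (c2045b1.conductorNorm ℤ)) (hopt : Zhai2021.IsOptimalDatum c2045b1 Dt) (hν : ¬ (2 : ℤ) ∣ Dt.c)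
    (hL : ∃ x : ℚ, IsLAlg c2045b1 x ∧ x ≠ 0 ∧ padicValRat 2 x = 0)
    (hF : IsTwoDivisionField c2045b1 F) (hsq : Squarefree M) (hM4 : M % 4 = 1) (hgcd : Int.gcd M 2045 = 1)
    (hne : M.natAbs.primeFactors.Nonempty) (hin : ∀ q ∈ M.natAbs.primeFactors, q ≠ 2 ∧ IsInertIn F q)
    (hsplit : ∀ (K : Type) [Field K] [NumberField K], Module.finrank ℚ K = 2 → (∃ x : K, x ^ 2 = (M : K)) →
      SatisfiesHeegnerHypothesis 2045 K)
    {c : VariableChange ℚ} (hc : c • c2045b1.quadraticTwist (M : ℚ) = W) : BSDp W 2 :=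
  bsdp_two_twist_zhaiSplit_of_print c2045b1 W hmod hGZK h11 h12 Dt hopt hν Δ_2045b1_neg not_hasRationalTwoTorsionX_2045b1 hL F hF
    (bsdp_two_2045b1_of_creutzMiller hCM hGZK (analyticRank_eq_zero_of_isLAlg c2045b1 hL)) M hsq hM4 (by rwa [conductorNorm_2045b1]) hne hin
    (by rw [conductorNorm_2045b1]; exact hsplit) hc

end SmallSeeds

end Summit.BirchSwinnertonDyer.BirchSwinnertonDyer.Theorems.AlignedTransportAtTwoTwistFamilyZhaiSplit

end
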